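import Summits.ResolutionOfSingularities.ResolutionOfSingularities.Theorems.PurelyInseparableDim4E2OfCJSLocalize
import HarnessLib

/-!
# F4-I(3,3) from CJS — the (β) «BINDERS ADDED» interface of record for rows (M-a)/(M-b)/(M-c)
# (cell `res-dim4-pi`, WORD #63; holder's typing — rows by NAME, all statements upstream of every consumer)

[OURS · counted 0 · AI work weaker than expert review.]  Cell `res-dim4-pi` (D-0157 DOOR 2), seat `res-dim4-p-2`
g2 (holder of the E2 transfer rows).  NOTHING here proves `GlobalModelReg`, `LocalizationRowReg`, `ModelRow`,
`NoIsolatedTrap 3 3` or resolution of singularities in dimension ≥ 4 / characteristic `p`.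

WHY.  Row (M-b) `LocalizationRow` (p665567) is proved modulo (M-c) `StrictTransformBlowup` (res-dim4-p-7 g2,
p667552), but (M-c) AS TYPED quantifies over every locally Noetherian ambient with only chart-local data and its
proof needs the «blow-up is local on the base» gluing; the tree's point form of (M-c) (res-dim4-p-5 g2, p667059
`StrictTransformBlowup.exists_isBlowup_subscheme_transform_point`) wants the ambient REGULAR and the marked ideal an
EFFECTIVE CARTIER divisor.  WORD #63 ruled (β): add these two binders.  Since `LocalizationRow` quantifies over an
ARBITRARY tower, the binders must enter the ROW's input and be PRODUCED by the global model.  This file types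
exactly that, so that every hand has a target by name:

* `GlobalModelReg` — (M-a)⁺: the global model of `globalModel_of_coneTwoChain` TOGETHER WITH the two tower
  invariants `∀ i, Scheme.IsRegular (Z i)` and `∀ i, IsEffectiveCartier (M i).ideal` (target of res-dim4-p-5 g2's
  tower induction: `theorem globalModelReg : GlobalModelReg`);
* `LocalizationRowReg` — (M-b)⁻: `LocalizationRow` with the two invariants as EXTRA HYPOTHESES (so it is implied by
  `LocalizationRow`, `localizationRowReg_of_localizationRow`; target of res-dim4-p-7 g2:
  `localizationRowReg_of_strictTransformReg : StrictTransformBlowupReg → LocalizationRowReg`, `StrictTransformBlowupReg`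
  = p-7's Prop with binders `(hZ : Scheme.IsRegular Z) (hM : IsEffectiveCartier M.ideal)`, typed by res-dim4-p-5 g2);
* the glue `modelRow_of_reg : GlobalModelReg → LocalizationRowReg → ModelRow` and the conditional assembly
  `noIsolatedTrap_three_three_of_CJS_reg : KeyTheorem640… → GlobalModelReg → LocalizationRowReg → NearRow →
  DirectrixRow → IsolationRow → NoIsolatedTrap 3 3` ((X) discharged by `settingRow`; (N), (E), (I) are theorems of
  the tree — plugged by name in `…E2OfCJSAssembly`, which imports their files).

[DIM4 · CJS-ROW] consumed: F-111 `KeyTheorem640_char_localized_isolated` only.  bears_on: LADDER-RESOLUTION:D157-DOOR2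
(res-dim4-pi · F4-I(3,3) · CJS dictionary · rows M-a/M-b interface).  Supports stmt-ResolutionOfSingularities-16155.
-/

set_option linter.dupNamespace false -- mandated namespace of this single-conjunct summit

noncomputable section

open CategoryTheory AlgebraicGeometry TopologicalSpace
open Literature.AlgebraicGeometry.Resolution
open Literature.AlgebraicGeometry.Resolution.Hauser2010
open Literature.AlgebraicGeometry.Resolution.AffinePointBlowup (P A ξ)
open Literature.AlgebraicGeometry.CossartJannsenSaito2020
open Scheme.IdealSheafData

namespace Summit.ResolutionOfSingularities.ResolutionOfSingularities.Theorems.PIDim4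

namespace E2OfCJS

open RidgeBudget (ebar)

/-- [OURS · row (M-a)⁺ GLOBAL MODEL WITH TOWER INVARIANTS · open] Over an algebraically closed field of
characteristic `3`, an E2-violating frame chain `c` has a global model — ambients `Z i`, marked ideals `M i` of
multiplicity `3`, closed points `x i`, open-immersion charts `φ i : 𝔸⁵ ⟶ Z i` with `φ i 0 = x i` and
`(M i).ideal.comap (φ i) = (z³ + (c i).F)·𝒪`, blowing ups `π i : Z (i+1) ⟶ Z i` of `x i` with
`M (i+1) = (M i).transform (π i) 𝓘_{x i}` and `π i (x (i+1)) = x i` (all this is `globalModel_of_coneTwoChain`,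
PROVED) — in which moreover EVERY AMBIENT IS REGULAR and EVERY MARKED IDEAL IS AN EFFECTIVE CARTIER DIVISOR (the two
tower invariants: `𝔸⁵` is regular and point blow-ups of regular schemes are regular; `(z³+F)·𝒪_{𝔸⁵}` is principal
non-zero and controlled transforms of effective Cartier divisors under point blow-ups of regular schemes are
effective Cartier).  NOT proved here. (OURS row — parameterless `Prop`, deliberately untagged; not asserted.) -/
def GlobalModelReg : Prop :=
  ∀ (K : Type) [Field K] [CharP K 3] [IsAlgClosed K] [DecidableEq K] (c : ℕ → State K),
    (∀ k, IsIsolated 3 (c k).F ∧ Step0 3 (c k) (c (k + 1)) ∧ ordZero (c k).F = (3 : ℕ∞) ∧ ebar (c k).F = 2) →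
    ∃ (Z : ℕ → Scheme.{0}) (_ : ∀ i, IsLocallyNoetherian (Z i)) (_ : ∀ i, JacobsonSpace ↥(Z i))
      (M : ∀ i, MarkedIdeal (Z i)) (x : ∀ i, ↥(Z i)) (hx : ∀ i, IsClosed ({x i} : Set (Z i)))
      (φ : ∀ i, P 4 K ⟶ Z i) (_ : ∀ i, IsOpenImmersion (φ i)) (π : ∀ i, Z (i + 1) ⟶ Z i),
      (∀ i, (M i).mult = 3 ∧ (φ i) (ξ 4 K) = x i ∧ (M i).ideal.comap (φ i) = hypSheaf 3 (c i).F ∧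
        IsBlowup (π i) (vanishingIdeal ⟨{x i}, hx i⟩) ∧
        M (i + 1) = (M i).transform (π i) (vanishingIdeal ⟨{x i}, hx i⟩) ∧ (π i) (x (i + 1)) = x i) ∧
      (∀ i, Scheme.IsRegular (Z i)) ∧ (∀ i, IsEffectiveCartier (M i).ideal)

/-- [OURS · row (M-b)⁻ LOCALISATION WITH TOWER INVARIANTS AS HYPOTHESES · open] The statement of
`LocalizationRow` (p665567) for global models whose ambients are REGULAR and whose marked ideals are EFFECTIVE
CARTIER divisors (two extra hypotheses after the model block; conclusion unchanged).  Weaker than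
`LocalizationRow` (`localizationRowReg_of_localizationRow`); it is what (M-c) in the (β) binder form delivers.
NOT proved here. (OURS row — parameterless `Prop`, deliberately untagged; not asserted.) -/
def LocalizationRowReg : Prop :=
  ∀ (K : Type) [Field K] [CharP K 3] [IsAlgClosed K] [DecidableEq K] (c : ℕ → State K),
    (∀ k, IsIsolated 3 (c k).F ∧ Step0 3 (c k) (c (k + 1)) ∧ ordZero (c k).F = (3 : ℕ∞) ∧ ebar (c k).F = 2) →
    ∀ (Z : ℕ → Scheme.{0}) (_ : ∀ i, IsLocallyNoetherian (Z i)) (_ : ∀ i, JacobsonSpace ↥(Z i))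
      (M : ∀ i, MarkedIdeal (Z i)) (x : ∀ i, ↥(Z i)) (hx : ∀ i, IsClosed ({x i} : Set (Z i)))
      (φ : ∀ i, P 4 K ⟶ Z i) (_ : ∀ i, IsOpenImmersion (φ i)) (π : ∀ i, Z (i + 1) ⟶ Z i),
      (∀ i, (M i).mult = 3 ∧ (φ i) (ξ 4 K) = x i ∧ (M i).ideal.comap (φ i) = hypSheaf 3 (c i).F ∧
        IsBlowup (π i) (vanishingIdeal ⟨{x i}, hx i⟩) ∧
        M (i + 1) = (M i).transform (π i) (vanishingIdeal ⟨{x i}, hx i⟩) ∧ (π i) (x (i + 1)) = x i) →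
      (∀ i, Scheme.IsRegular (Z i)) → (∀ i, IsEffectiveCartier (M i).ideal) →
    ∃ (S B : ℕ → Scheme.{0}) (_ : ∀ i, IsLocallyNoetherian (S i)) (_ : ∀ i, IsLocallyNoetherian (B i))
      (π' : ∀ i, B i ⟶ S i) (pt : ∀ i, ↥(S i)) (b : ∀ i, ↥(B i)) (hcl : ∀ i, IsClosed ({pt i} : Set (S i))),
      (∀ i, IsBlowup (π' i) (vanishingIdeal ⟨{pt i}, hcl i⟩)) ∧ (∀ i, (π' i).base (b i) = pt i) ∧
      (∀ i, IsClosed ({b i} : Set (B i))) ∧ (∀ i, IsLocalSchemeAt (S (i + 1)) (pt (i + 1)) (B i) (b i)) ∧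
      (∀ i, IsLocalAt (S i) (pt i)) ∧
      (∀ i, PresentedBy K (c i).F (S i) (pt i)) ∧ (∀ i, PresentedBy K (c (i + 1)).F (B i) (b i))

/-- `LocalizationRow ⇒ LocalizationRowReg` (the invariants are simply discarded). [OURS · glue] [folklore] -/
theorem localizationRowReg_of_localizationRow (h : LocalizationRow) : LocalizationRowReg := by
  intro K _ _ _ _ c hc Z hZ hJ M x hx φ hφ π hall _ _
  exact h K c hc Z hZ hJ M x hx φ hφ π hall

/-- `GlobalModelReg` refines `globalModel_of_coneTwoChain`: forgetting the invariants gives the plain global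
model. [OURS · glue] [folklore] -/
theorem globalModel_of_globalModelReg (hG : GlobalModelReg) (K : Type) [Field K] [CharP K 3] [IsAlgClosed K]
    [DecidableEq K] (c : ℕ → State K)
    (hc : ∀ k, IsIsolated 3 (c k).F ∧ Step0 3 (c k) (c (k + 1)) ∧ ordZero (c k).F = (3 : ℕ∞) ∧ ebar (c k).F = 2) :
    ∃ (Z : ℕ → Scheme.{0}) (_ : ∀ i, IsLocallyNoetherian (Z i)) (_ : ∀ i, JacobsonSpace ↥(Z i))
      (M : ∀ i, MarkedIdeal (Z i)) (x : ∀ i, ↥(Z i)) (hx : ∀ i, IsClosed ({x i} : Set (Z i)))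
      (φ : ∀ i, P 4 K ⟶ Z i) (_ : ∀ i, IsOpenImmersion (φ i)) (π : ∀ i, Z (i + 1) ⟶ Z i),
      ∀ i, (M i).mult = 3 ∧ (φ i) (ξ 4 K) = x i ∧ (M i).ideal.comap (φ i) = hypSheaf 3 (c i).F ∧
        IsBlowup (π i) (vanishingIdeal ⟨{x i}, hx i⟩) ∧
        M (i + 1) = (M i).transform (π i) (vanishingIdeal ⟨{x i}, hx i⟩) ∧ (π i) (x (i + 1)) = x i := by
  obtain ⟨Z, hZ, hJ, M, x, hx, φ, hφ, π, hall, -, -⟩ := hG K c hc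
  exact ⟨Z, hZ, hJ, M, x, hx, φ, hφ, π, hall⟩

/-- **(M-a)⁺ ∧ (M-b)⁻ ⇒ (M)**: a global model WITH the tower invariants and the localisation row in the binder
form give `ModelRow`. [OURS · glue] [folklore] -/
theorem modelRow_of_reg (hG : GlobalModelReg) (h : LocalizationRowReg) : ModelRow := by
  intro K _ _ _ _ c hc
  obtain ⟨Z, hZ, hJ, M, x, hx, φ, hφ, π, hall, hreg, hcart⟩ := hG K c hc
  exact h K c hc Z hZ hJ M x hx φ hφ π hall hreg hcart

/-- **F4-I(3,3) from CJS Thm. 6.40 in the (β) binder form**: with (X) discharged (`settingRow`), the crux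
`NoIsolatedTrap 3 3` follows from the named fact `KeyTheorem640_char_localized_isolated` and the rows (M-a)⁺
`GlobalModelReg`, (M-b)⁻ `LocalizationRowReg`, (N), (E), (I) — the last three being theorems of the tree
(`nearRow`, `directrixRow`, `isolationRow`; plugged by name downstream). [OURS · conditional assembly]
[cite: CossartJannsenSaito2020, Thm. 6.40] -/
theorem noIsolatedTrap_three_three_of_CJS_reg (hK640 : KeyTheorem640_char_localized_isolated.{0})
    (hG : GlobalModelReg) (hMb : LocalizationRowReg) (hN : NearRow) (hE : DirectrixRow) (hI : IsolationRow) :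
    NoIsolatedTrap 3 3 :=
  noIsolatedTrap_three_three_of_CJS_rows hK640 (modelRow_of_reg hG hMb) hN hE hI settingRow

/-- The algebraically-closed transfer statement of p663940 from the (β) rows. [OURS · glue] [folklore] -/
theorem isolatedConeTwoChainLocalizesAlgClosed_of_reg (hG : GlobalModelReg) (hMb : LocalizationRowReg)
    (hN : NearRow) (hE : DirectrixRow) (hI : IsolationRow) : IsolatedConeTwoChainLocalizesAlgClosed :=
  isolatedConeTwoChainLocalizesAlgClosed_of_rows (modelRow_of_reg hG hMb) hN hE hI settingRow

end E2OfCJS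

end Summit.ResolutionOfSingularities.ResolutionOfSingularities.Theorems.PIDim4

end
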